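import Summits.AtomisticToContinuum.Crystallization.Theorems.FreeSplittingCertificatesStrictSplittingRuleP1TwoSiteLedger
import Summits.AtomisticToContinuum.Crystallization.Theorems.FreeSplittingCertificatesStrictSplittingRuleP1SiteLedgerExact

/-!
# `StrictSplittingRule` (stmt-AtomisticToContinuum-12560): H12⋆ from the two site ledgers with the per-cell budget in EXACT-DEFECT form (P1 interpolant object, part 71)

Route `FreeSplittingCertificates`, crux r3 `StrictSplittingRule` (H12⋆ = `stub_coreJointCoercive`), unit b2b-freesplit-B gen 34.
VALUE = part 57's `coreJointCoercive_of_ledgers` RE-THREADED on part 70: `CoreJointCoercive a h κ₁ κ₃` from, per representative, ANY far-share /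
routing data (all side conditions now only AT THE TWO REPRESENTATIVES), the per-cell budget (B) with the EXACT defect `p1CellDefectG` (no circumradius data) and the near-ledger inequality `hNear`.
Composition of `coreJointCoercive_of_siteIneq` (part 57, unchanged) with `coreJointSiteIneq_of_ledgers_exact` (part 70).
NOT a proof of H12⋆ (hB + hNear are hypotheses), NOT summit progress.  [folklore]
-/

noncomputable section

open Set Function Metric MeasureTheory Filter Topology
open scoped BigOperators NNReal ENNReal Classical

namespace Summit.AtomisticToContinuum.Crystallization.Theorems.StrictSplittingRuleBirth

open Literature.MathematicalPhysics.StatisticalMechanics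
open Summit.AtomisticToContinuum.Crystallization.Theorems.PalmUnimodularRigidity.LayeredLawsSelectHcp

/-- **H12⋆ FROM THE TWO SITE LEDGERS (exact defect).**  See the module docstring.  NOT a proof of H12⋆, NOT summit progress. -/
theorem coreJointCoercive_of_ledgers_exact {a h κ₁ κ₃ : ℝ} (ha : 0 < a) (hh : 0 < h) (hfam : HcpFamilyMin a h)
    (Y₁ : Finset (ℤ × ℤ × ℤ)) (β : Bool → (ℤ × ℤ × ℤ) → (ℤ × ℤ × ℤ) → ℝ)
    (hY₁ : ∀ b d s, s ∉ Y₁ → β b d s = 0)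
    {Cβ : ℝ} (hβ : ∀ p q : ℤ × ℤ × ℤ, ∀ s, |β (decide (Even p.1)) (q - p) s| ≤ Cβ * ((1 + ‖hcpSite a h q - hcpSite a h p‖)⁻¹) ^ 6)
    (hH1 : ∀ u : ℤ × ℤ × ℤ → EuclideanSpace ℝ (Fin 3), (support u).Finite →
      ∀ p ∈ ({(0, 0, 0), (1, 0, 0)} : Finset (ℤ × ℤ × ℤ)),
        (∑' q : ℤ × ℤ × ℤ, (if q = p then (0 : ℝ) else
            ljSqDeriv (‖hcpSite a h q - hcpSite a h p‖ ^ 2) *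
              inner ℝ (hcpSite a h q - hcpSite a h p) (u q - u p))) +
          (∑' q : ℤ × ℤ × ℤ, (if q = p then (0 : ℝ) else
            ∑ s ∈ Y₁, (β (decide (Even p.1)) (q - p) s *
                inner ℝ (hcpSite a h (p + s) - hcpSite a h p) (u (p + s) - u p) -
              β (decide (Even q.1)) (p - q) s *
                inner ℝ (hcpSite a h (q + s) - hcpSite a h q) (u (q + s) - u q)))) = 0)
    (M₁ N M : Bool → (ℤ × ℤ × ℤ) → (ℤ × ℤ × ℤ) → (ℤ × ℤ × ℤ) → ℝ)
    (hMN₁ : ∀ b d s s', s ∉ p1BondOffsets ∨ s' ∉ p1BondOffsets → M₁ b d s s' = 0 ∧ N b d s s' = 0)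
    {C₁ : ℝ} (hdec₁ : ∀ p q : ℤ × ℤ × ℤ, ∀ s s', |M₁ (decide (Even p.1)) (q - p) s s'| ≤
        C₁ * ((1 + ‖hcpSite a h q - hcpSite a h p‖)⁻¹) ^ 6 ∧
      |N (decide (Even p.1)) (q - p) s s'| ≤ C₁ * ((1 + ‖hcpSite a h q - hcpSite a h p‖)⁻¹) ^ 6)
    {R1 R2 : ℝ} (hR1 : 0 < R1) (hR12 : R1 < R2) {κ : ℝ} (hκ : 0 ≤ κ)
    (hM : ∀ b e s s', M b e s s' = M₁ b e s s' + (fun b e s s' => if s = s' then -(κ * (2 / 5) / a ^ 4 * p1RecTable a h (p1SplitDensity R1 R2) b e s) else 0) b e s s')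
    -- per representative: in-layer far shares and their allocation table
    (w : (ℤ × ℤ × ℤ) → (ℤ × ℤ × ℤ) × (ℤ × ℤ × ℤ) → ℝ) (hw : ∀ p ∈ ({(0, 0, 0), (1, 0, 0)} : Finset (ℤ × ℤ × ℤ)), ∀ e, 0 ≤ w p e)
    (hws : ∀ p ∈ ({(0, 0, 0), (1, 0, 0)} : Finset (ℤ × ℤ × ℤ)),
      Summable fun e : (ℤ × ℤ × ℤ) × (ℤ × ℤ × ℤ) => w p e * fpSq (fun k => hcpSite a h (e.1 + e.2) k - hcpSite a h e.1 k))
    (θ : (ℤ × ℤ × ℤ) → (ℤ × ℤ × ℤ) × (ℤ × ℤ × ℤ) → (ℤ × ℤ × ℤ) × Fin 6 → ℝ) (hθ : ∀ p ∈ ({(0, 0, 0), (1, 0, 0)} : Finset (ℤ × ℤ × ℤ)), ∀ e T, 0 ≤ θ p e T)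
    (hfinE : ∀ p ∈ ({(0, 0, 0), (1, 0, 0)} : Finset (ℤ × ℤ × ℤ)), ∀ e, (Function.support (θ p e)).Finite)
    (hfinC : ∀ p ∈ ({(0, 0, 0), (1, 0, 0)} : Finset (ℤ × ℤ × ℤ)), ∀ T, (Function.support fun e => θ p e T).Finite)
    (hsum : ∀ p ∈ ({(0, 0, 0), (1, 0, 0)} : Finset (ℤ × ℤ × ℤ)), ∀ e, w p e ≠ 0 → ∑ᶠ T, θ p e T = 1)
    (hcar : ∀ p ∈ ({(0, 0, 0), (1, 0, 0)} : Finset (ℤ × ℤ × ℤ)), ∀ e T, θ p e T ≠ 0 → ∃ m m' : Fin 4, e.1 = T.1 + p1VertOff (p1Par T.1) T.2 m ∧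
      e.1 + e.2 = T.1 + p1VertOff (p1Par T.1) T.2 m')
    -- per representative: vertical far shares, routing offsets and their allocation table
    (sv : (ℤ × ℤ × ℤ) → ℤ × ℤ × ℤ) (o : (ℤ × ℤ × ℤ) → (ℤ × ℤ × ℤ) → Fin 3 → ℤ × ℤ × ℤ) (S : Finset (ℤ × ℤ × ℤ))
    (ho : ∀ p ∈ ({(0, 0, 0), (1, 0, 0)} : Finset (ℤ × ℤ × ℤ)), ∀ q i, o p q i ∈ S)
    (wv : (ℤ × ℤ × ℤ) → (ℤ × ℤ × ℤ) → ℝ) (hwv : ∀ p ∈ ({(0, 0, 0), (1, 0, 0)} : Finset (ℤ × ℤ × ℤ)), ∀ q, 0 ≤ wv p q)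
    (hwvs : ∀ p ∈ ({(0, 0, 0), (1, 0, 0)} : Finset (ℤ × ℤ × ℤ)), Summable (wv p))
    (θv : (ℤ × ℤ × ℤ) → (ℤ × ℤ × ℤ) × (ℤ × ℤ × ℤ) → (ℤ × ℤ × ℤ) × Fin 6 → ℝ) (hθv : ∀ p ∈ ({(0, 0, 0), (1, 0, 0)} : Finset (ℤ × ℤ × ℤ)), ∀ e T, 0 ≤ θv p e T)
    (hfinEv : ∀ p ∈ ({(0, 0, 0), (1, 0, 0)} : Finset (ℤ × ℤ × ℤ)), ∀ e, (Function.support (θv p e)).Finite)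
    (hfinCv : ∀ p ∈ ({(0, 0, 0), (1, 0, 0)} : Finset (ℤ × ℤ × ℤ)), ∀ T, (Function.support fun e => θv p e T).Finite)
    (hsumv : ∀ p ∈ ({(0, 0, 0), (1, 0, 0)} : Finset (ℤ × ℤ × ℤ)), ∀ e, (∑ i : Fin 3, (2 / 3) * ((if e.2 = o p e.1 i then wv p e.1 else 0) +
        (if o p (e.1 - (sv p - e.2)) i = sv p - e.2 then wv p (e.1 - (sv p - e.2)) else 0))) ≠ 0 → ∑ᶠ T, θv p e T = 1)
    (hcarv : ∀ p ∈ ({(0, 0, 0), (1, 0, 0)} : Finset (ℤ × ℤ × ℤ)), ∀ e T, θv p e T ≠ 0 → ∃ m m' : Fin 4, e.1 = T.1 + p1VertOff (p1Par T.1) T.2 m ∧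
      e.1 + e.2 = T.1 + p1VertOff (p1Par T.1) T.2 m')
    -- THE PER-CELL BUDGET (B) at each representative: dyad readout + EXACT defect form (part 68), weights re-centred at `y_p`
    (hB : ∀ p ∈ ({(0, 0, 0), (1, 0, 0)} : Finset (ℤ × ℤ × ℤ)), ∀ (T : (ℤ × ℤ × ℤ) × Fin 6) (G : Fin 3 → Fin 3 → ℝ),
      (∑ᶠ e : (ℤ × ℤ × ℤ) × (ℤ × ℤ × ℤ), θ p e T * w p e *
          fpSq (fun k => (hcpSite a h (e.1 + e.2) 0 - hcpSite a h e.1 0) * G 0 k +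
            (hcpSite a h (e.1 + e.2) 1 - hcpSite a h e.1 1) * G 1 k + (hcpSite a h (e.1 + e.2) 2 - hcpSite a h e.1 2) * G 2 k)) +
      (∑ᶠ e : (ℤ × ℤ × ℤ) × (ℤ × ℤ × ℤ), θv p e T *
          (∑ i : Fin 3, (2 / 3) * ((if e.2 = o p e.1 i then wv p e.1 else 0) +
            (if o p (e.1 - (sv p - e.2)) i = sv p - e.2 then wv p (e.1 - (sv p - e.2)) else 0))) *
          fpSq (fun k => (hcpSite a h (e.1 + e.2) 0 - hcpSite a h e.1 0) * G 0 k +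
            (hcpSite a h (e.1 + e.2) 1 - hcpSite a h e.1 1) * G 1 k + (hcpSite a h (e.1 + e.2) 2 - hcpSite a h e.1 2) * G 2 k)) +
      p1CellDefectG a h (fun y k l => κ * ((7 * (5 / 4 : ℝ) + 3 / 4) / 4) * fpChi (R1 ^ 2) (R2 ^ 2) (y - fun k => hcpSite a h p k) ^ 2 *
          (fpSq (y - fun k => hcpSite a h p k))⁻¹ ^ 5 * ((y - fun k => hcpSite a h p k) k * (y - fun k => hcpSite a h p k) l)) T G ≤
      κ * ((5 / 2 * (1 / 24 * fpSymSq G) + 5 / 2 * (1 / 24 * (fpFrob G - fpSymSq G))) *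
        ∫ y in p1RealCell a h T, fpChi (R1 ^ 2) (R2 ^ 2) (y - fun k => hcpSite a h p k) ^ 2 * (fpSq (y - fun k => hcpSite a h p k))⁻¹ ^ 3))
    -- THE NEAR-LEDGER INEQUALITY at each representative, for every finitely supported `u` (certificate tier + identification, G9)
    (hNear : ∀ p ∈ ({(0, 0, 0), (1, 0, 0)} : Finset (ℤ × ℤ × ℤ)), ∀ u : ℤ × ℤ × ℤ → EuclideanSpace ℝ (Fin 3), (support u).Finite →
      ∀ (W : EuclideanSpace ℝ (Fin 3) →ₗ[ℝ] EuclideanSpace ℝ (Fin 3)),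
      (∀ z : EuclideanSpace ℝ (Fin 3), inner ℝ (W z) z = 0) →
      (∀ W' : EuclideanSpace ℝ (Fin 3) →ₗ[ℝ] EuclideanSpace ℝ (Fin 3), (∀ z : EuclideanSpace ℝ (Fin 3), inner ℝ (W' z) z = 0) →
        (∑' q : ℤ × ℤ × ℤ,
            (if 0 < ‖hcpSite a h q - hcpSite a h p‖ ∧ ‖hcpSite a h q - hcpSite a h p‖ ≤ 11 / 10 * a then
              ‖u q - u p - W (hcpSite a h q - hcpSite a h p)‖ ^ 2 else (0 : ℝ))) ≤
        (∑' q : ℤ × ℤ × ℤ,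
            (if 0 < ‖hcpSite a h q - hcpSite a h p‖ ∧ ‖hcpSite a h q - hcpSite a h p‖ ≤ 11 / 10 * a then
              ‖u q - u p - W' (hcpSite a h q - hcpSite a h p)‖ ^ 2 else (0 : ℝ)))) →
      ∀ (A : Fin 3 → Fin 3 → ℝ), (∀ (y : EuclideanSpace ℝ (Fin 3)) (k : Fin 3), W y k = y 0 * A 0 k + y 1 * A 1 k + y 2 * A 2 k) →
      κ₁ * (∑' q : ℤ × ℤ × ℤ,
        (if 0 < ‖hcpSite a h q - hcpSite a h p‖ ∧ ‖hcpSite a h q - hcpSite a h p‖ ≤ 11 / 10 * a then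
          (inner ℝ (hcpSite a h q - hcpSite a h p) (u q - u p)) ^ 2 else (0 : ℝ))) +
      κ₃ * (∑' q : ℤ × ℤ × ℤ,
        (if 0 < ‖hcpSite a h q - hcpSite a h p‖ ∧ ‖hcpSite a h q - hcpSite a h p‖ ≤ 11 / 10 * a then
          ‖u q - u p - W (hcpSite a h q - hcpSite a h p)‖ ^ 2 else (0 : ℝ))) +
      (∑' q : ℤ × ℤ × ℤ, (if q = p then (0 : ℝ) else
        ∑ s ∈ Y₁,
          (β (decide (Even q.1)) (p - q) s *
              (1 / 2 * ‖u (q + s) - u q - W (hcpSite a h (q + s) - hcpSite a h q)‖ ^ 2) -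
            β (decide (Even p.1)) (q - p) s *
              (1 / 2 * ‖u (p + s) - u p - W (hcpSite a h (p + s) - hcpSite a h p)‖ ^ 2)))) -
      ((∑' e : (ℤ × ℤ × ℤ) × (ℤ × ℤ × ℤ), w p e * ‖u (e.1 + e.2) - u e.1 - W (hcpSite a h (e.1 + e.2) - hcpSite a h e.1)‖ ^ 2) +
    (∑' q : ℤ × ℤ × ℤ, wv p q * ‖u (q + sv p) - u q - W (hcpSite a h (q + sv p) - hcpSite a h q)‖ ^ 2) +
    (∑' q, p1SiteBare a h (fun y k l => κ * ((7 * (5 / 4 : ℝ) + 3 / 4) / 4) * fpChi (R1 ^ 2) (R2 ^ 2) (y - fun k => hcpSite a h p k) ^ 2 *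
        (fpSq (y - fun k => hcpSite a h p k))⁻¹ ^ 5 * ((y - fun k => hcpSite a h p k) k * (y - fun k => hcpSite a h p k) l))
        (fun n k => p1DispSite a h (fun n k => u n k) (fun k => u p k - (hcpSite a h p 0 * A 0 k + hcpSite a h p 1 * A 1 k + hcpSite a h p 2 * A 2 k)) A n k) q) -
    (∑' q, p1SiteBare a h (fun y k l => κ * ((3 / 4 : ℝ) / 4) * fpChi (R1 ^ 2) (R2 ^ 2) (y - fun k => hcpSite a h p k) ^ 2 *
        (fpSq (y - fun k => hcpSite a h p k))⁻¹ ^ 4 * (if k = l then 1 else 0))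
        (fun n k => p1DispSite a h (fun n k => u n k) (fun k => u p k - (hcpSite a h p 0 * A 0 k + hcpSite a h p 1 * A 1 k + hcpSite a h p 2 * A 2 k)) A n k) q)) -
      (∑' q : ℤ × ℤ × ℤ, (if q = p then (0 : ℝ) else
        1 / 2 * (ljSqDeriv (‖hcpSite a h q - hcpSite a h p‖ ^ 2) *
            ‖u q - u p - W (hcpSite a h q - hcpSite a h p)‖ ^ 2 +
          2 * (1 / 2 * (7 * ((‖hcpSite a h q - hcpSite a h p‖ ^ 2)⁻¹) ^ 8 -
            4 * ((‖hcpSite a h q - hcpSite a h p‖ ^ 2)⁻¹) ^ 5)) *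
            (inner ℝ (hcpSite a h q - hcpSite a h p) (u q - u p)) ^ 2))) -
      (∑' q : ℤ × ℤ × ℤ, (if q = p then (0 : ℝ) else
        ∑ s ∈ p1BondOffsets, ∑ s' ∈ p1BondOffsets,
          (M₁ (decide (Even p.1)) (q - p) s s' *
              (inner ℝ (hcpSite a h (p + s) - hcpSite a h p) (u (p + s) - u p) *
                inner ℝ (hcpSite a h (p + s') - hcpSite a h p) (u (p + s') - u p)) -
            M₁ (decide (Even q.1)) (p - q) s s' *
              (inner ℝ (hcpSite a h (q + s) - hcpSite a h q) (u (q + s) - u q) *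
                inner ℝ (hcpSite a h (q + s') - hcpSite a h q) (u (q + s') - u q)) +
            (N (decide (Even p.1)) (q - p) s s' - N (decide (Even q.1)) (p - q) s' s) *
              (inner ℝ (hcpSite a h (p + s) - hcpSite a h p) (u (p + s) - u p) *
                inner ℝ (hcpSite a h (q + s') - hcpSite a h q) (u (q + s') - u q))))) +
      κ * (2 / 5) / a ^ 4 * (∑' q : ℤ × ℤ × ℤ, if q = p then (0 : ℝ) else
        ∑ s ∈ p1BondOffsets, p1RecTable a h (p1SplitDensity R1 R2) (decide (Even p.1)) (q - p) s *
          (inner ℝ (hcpSite a h (p + s) - hcpSite a h p) (u (p + s) - u p)) ^ 2) +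
      κ * (2 / 5) / a ^ 4 * (∑ d ∈ p1BondOffsets, p1RecTable a h (p1SplitDensity R1 R2) (p1Par p) (p - p) d *
          (inner ℝ (hcpSite a h (p + d) - hcpSite a h p) (u (p + d) - u p)) ^ 2) +
      κ * (∑' i, p1FluxQuad₀ (R1 ^ 2) (R2 ^ 2) (1 / 3) (4 / 3) (-9 / 8) (1 / 8) a h (fun k => hcpSite a h p k) i
        (p1CellVals (fun n k => p1DispSite a h (fun n k => u n k) (fun k => u p k - (hcpSite a h p 0 * A 0 k + hcpSite a h p 1 * A 1 k + hcpSite a h p 2 * A 2 k)) A n k) i)) ≤ 0) :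
    CoreJointCoercive a h κ₁ κ₃ := by
  refine coreJointCoercive_of_siteIneq ha hh Y₁ β hY₁ hβ hH1 M₁ N M hMN₁ hdec₁ hR1 hR12 hκ hM fun u hu p hp => ?_
  have hTR₁ := stub_summableTransfer a h C₁ ha hh p1BondOffsets M₁ N hdec₁ u hu p
  exact coreJointSiteIneq_of_ledgers_exact ha hh hfam Y₁ β M₁ M N hR1 hR12 hκ hM u hu p hTR₁
    (w p) (hw p hp) (hws p hp) (θ p) (hθ p hp) (hfinE p hp) (hfinC p hp) (hsum p hp) (hcar p hp)
    (sv p) (o p) S (ho p hp) (wv p) (hwv p hp) (hwvs p hp) (θv p) (hθv p hp) (hfinEv p hp) (hfinCv p hp) (hsumv p hp) (hcarv p hp)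
    (hB p hp) (hNear p hp u hu)

end Summit.AtomisticToContinuum.Crystallization.Theorems.StrictSplittingRuleBirth

end
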